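import Mathlib.LinearAlgebra.Matrix.NonsingularInverse
import Literature.Probability.LatticeModels.LatticeGreenPoisson
import HarnessLib

/-!
# The Dirichlet Green function of a finite subset of `ℤ^d` and its Poisson kernel

Topic `Literature/Probability/LatticeModels`. Deterministic lattice potential theory for the proof
of `Literature.Probability.LatticeModels.Lupu2016_cableSignClustersBounded` (Lupu 2016,
Prop. 5.5): the finite-volume (Dirichlet) free fields `ψ^Λ` of the boxes `Λ = Λ_n`, by which Lupu
approximates the free field of `ℤ^d` (proof of his Prop. 4.2, last paragraph: finite sub-graphs
"with instant killing at reaching `V_n ∖ V_{n-1}`", `ψ^{V_{n-1}} → ψ` in law), have covariance the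
Dirichlet Green function `G_Λ` built here, and `ψ^{Λ_n} → φ` is `G_{Λ_n} → G` proved here.

For finite `Λ ⊆ ℤ^d`, `M_Λ = 2d·1 - A_Λ` (`dirichletMatrix`) is `-Δ` with zero boundary condition
(`mulVec_dirichletMatrix`); it is invertible for `d ≥ 1` (`isUnit_dirichletMatrix`: a solution of
`M_Λ u = 0` is harmonic in `Λ` with zero boundary values, so vanishes by the tree's
`IsZdHarmonicOn.eq_of_eq_boundary`). `dirichletGreen Λ = M_Λ⁻¹` (extended by `0`) is symmetric,
solves `-Δ_y G_Λ(x,·) = δ_x` on `Λ` and is `≥ 0` (minimum principle); `poissonKernel Λ x z =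
∑_{w ∼ z} G_Λ(x,w)` (`z ∉ Λ`) is `≥ 0`; **Green's representation formula**
`F x = ∑_{y ∈ Λ} G_Λ(x,y)(-ΔF)(y) + ∑_{z ∈ ∂Λ} H_Λ(x,z) F z` (`green_representation`) gives
`∑_z H_Λ(x,z) = 1`; the companion file `DirichletGreenLimit.lean` deduces, for `d ≥ 3` and
`G = latticeGreen / 2`, `G(x-y) = [y ∈ Λ] G_Λ(x,y) + ∑_z H_Λ(x,z) G(z-y)` and
`G_{Λ_n}(x,y) → G(x-y)`.

References: G. F. Lawler, *Intersections of Random Walks* (1991), §1.4–1.5 (Green's function of a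
finite set, harmonic measure `H_A`; bib key `Lawler1991`); T. Lupu, Ann. Probab. 44 (2016), proof
of Prop. 4.2 (`Lupu2016`). Classical material, tagged `[folklore]` unless a locator is given.
-/

noncomputable section

namespace Literature.Probability.LatticeModels

open Finset Filter Matrix _root_.Topology

variable {d : ℕ}

/-! ### Zero extension and the Dirichlet Laplacian matrix -/

/-- Extension by zero of a function on the finite set `Λ ⊆ ℤ^d` to all of `ℤ^d`. [folklore] -/
def zeroExtend (Λ : Finset (Site d)) (u : Λ → ℝ) : Site d → ℝ :=
  fun x => if hx : x ∈ Λ then u ⟨x, hx⟩ else 0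

/-- `zeroExtend` on `Λ`. [folklore] -/
theorem zeroExtend_of_mem {Λ : Finset (Site d)} (u : Λ → ℝ) {x : Site d} (hx : x ∈ Λ) :
    zeroExtend Λ u x = u ⟨x, hx⟩ := by simp only [zeroExtend, hx, dite_true]

/-- `zeroExtend` at a point of `Λ` (subtype form). [folklore] -/
@[simp] theorem zeroExtend_coe {Λ : Finset (Site d)} (u : Λ → ℝ) (x : Λ) :
    zeroExtend Λ u x = u x := by rw [zeroExtend_of_mem u x.2]

/-- `zeroExtend` vanishes off `Λ`. [folklore] -/
theorem zeroExtend_of_not_mem {Λ : Finset (Site d)} (u : Λ → ℝ) {x : Site d} (hx : x ∉ Λ) :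
    zeroExtend Λ u x = 0 := by simp only [zeroExtend, hx, dite_false]

/-- The **Dirichlet Laplacian matrix** of the finite set `Λ ⊆ ℤ^d`: `M_Λ = 2d·1 - A_Λ`, i.e.
`(M_Λ)_{xy} = 2d` if `x = y`, `-1` if `x ∼ y`, `0` otherwise (`x, y ∈ Λ`); this is `-Δ` with zero
boundary condition outside `Λ` (Lawler 1991, §1.4: `Δ = 2d (P - I)`, `P_A` the walk killed on
leaving `A`). [folklore] -/
def dirichletMatrix (Λ : Finset (Site d)) : Matrix Λ Λ ℝ :=
  fun x y => if x = y then 2 * d else if (zdGraph d).Adj x y then -1 else 0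

/-- `M_Λ` is symmetric. [folklore] -/
theorem dirichletMatrix_transpose (Λ : Finset (Site d)) :
    (dirichletMatrix Λ)ᵀ = dirichletMatrix Λ := by
  ext x y
  simp only [transpose_apply, dirichletMatrix]
  by_cases h : x = y
  · subst h; simp
  · have h' : y ≠ x := fun h' => h h'.symm
    simp only [h, h', if_false, (zdGraph d).adj_comm]

/-- A sum over `Λ` of a function vanishing outside `Λ`, restricted to the neighbours of `z`, is the
sum over all lattice neighbours of `z`. [folklore] -/
theorem sum_filter_adj_eq_sum_neighborFinset (Λ : Finset (Site d)) {g : Site d → ℝ}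
    (hg : ∀ y ∉ Λ, g y = 0) (z : Site d) :
    ∑ y ∈ Λ.filter (fun y => (zdGraph d).Adj z y), g y =
      ∑ y ∈ (zdGraph d).neighborFinset z, g y := by
  classical
  have h1 : ∑ y ∈ (zdGraph d).neighborFinset z, g y =
      ∑ y ∈ ((zdGraph d).neighborFinset z).filter (fun y => y ∈ Λ), g y := by
    rw [Finset.sum_filter]
    refine Finset.sum_congr rfl fun y _ => ?_
    by_cases hy : y ∈ Λ
    · rw [if_pos hy]
    · rw [if_neg hy, hg y hy]
  rw [h1]
  refine Finset.sum_congr ?_ fun _ _ => rfl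
  ext y
  simp only [Finset.mem_filter, SimpleGraph.mem_neighborFinset]
  tauto

/-- **`M_Λ u = -Δ ū` on `Λ`**, `ū = zeroExtend Λ u`. [folklore] -/
theorem mulVec_dirichletMatrix (Λ : Finset (Site d)) (u : Λ → ℝ) (x : Λ) :
    (dirichletMatrix Λ *ᵥ u) x = -latticeLaplacianZd (zeroExtend Λ u) x := by
  classical
  have hcard := card_neighborFinset_zdGraph_holds (d := d) (x : Site d)
  rw [latticeLaplacianZd_eq_sum_neighborFinset, Finset.sum_sub_distrib, Finset.sum_const, hcard,
    nsmul_eq_mul, zeroExtend_coe]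
  rw [mulVec, dotProduct]
  -- split the matrix row into its diagonal and off-diagonal parts
  have hsplit : ∑ y, dirichletMatrix Λ x y * u y =
      2 * d * u x - ∑ y : Λ, (if (zdGraph d).Adj (x : Site d) (y : Site d) then u y else 0) := by
    have : ∀ y : Λ, dirichletMatrix Λ x y * u y =
        (if x = y then 2 * d * u y else 0) -
          (if (zdGraph d).Adj (x : Site d) (y : Site d) then u y else 0) := by
      intro y
      simp only [dirichletMatrix]
      by_cases hxy : x = y
      · subst hxy
        simp [SimpleGraph.irrefl]
      · simp only [hxy, if_false]
        split_ifs <;> ring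
    simp_rw [this, Finset.sum_sub_distrib, Finset.sum_ite_eq, Finset.mem_univ, if_true]
  rw [hsplit]
  -- the off-diagonal part is the sum over the lattice neighbours
  have hoff : ∑ y : Λ, (if (zdGraph d).Adj (x : Site d) (y : Site d) then u y else 0) =
      ∑ y ∈ (zdGraph d).neighborFinset (x : Site d), zeroExtend Λ u y := by
    rw [← sum_filter_adj_eq_sum_neighborFinset Λ (fun y hy => zeroExtend_of_not_mem u hy),
      Finset.sum_filter, ← Finset.sum_coe_sort Λ]
    refine Finset.sum_congr rfl fun y _ => ?_
    simp only [zeroExtend_coe]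
  rw [hoff]
  push_cast
  ring

/-- The zero extension of a solution of `M_Λ u = 0` is harmonic in `Λ`. [folklore] -/
theorem isZdHarmonicOn_zeroExtend_of_mulVec_eq_zero {Λ : Finset (Site d)} {u : Λ → ℝ}
    (hu : dirichletMatrix Λ *ᵥ u = 0) : IsZdHarmonicOn (zeroExtend Λ u) ↑Λ := by
  intro x hx
  have h := mulVec_dirichletMatrix Λ u ⟨x, hx⟩
  rw [hu, Pi.zero_apply] at h
  linarith

/-- **`M_Λ` is injective** (`d ≥ 1`): a solution of `M_Λ u = 0` extends by zero to a function
harmonic in `Λ` vanishing on `∂Λ`, hence vanishing on `Λ` by uniqueness for the discrete Dirichlet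
problem (`IsZdHarmonicOn.eq_of_eq_boundary`, Lawler 1991, §1.4). [cite: Lawler1991, §1.4, p. 25] -/
theorem mulVec_dirichletMatrix_injective (hd : 0 < d) (Λ : Finset (Site d)) :
    Function.Injective (dirichletMatrix Λ).mulVec := by
  intro u v huv
  have h0 : dirichletMatrix Λ *ᵥ (u - v) = 0 := by rw [mulVec_sub, huv, sub_self]
  have hharm := isZdHarmonicOn_zeroExtend_of_mulVec_eq_zero h0
  have hzero : IsZdHarmonicOn (0 : Site d → ℝ) ↑Λ := fun x _ => latticeLaplacianZd_zero x
  have hb : ∀ y ∈ zdOuterBoundary (↑Λ : Set (Site d)), zeroExtend Λ (u - v) y = (0 : Site d → ℝ) y :=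
    fun y hy => by rw [Pi.zero_apply, zeroExtend_of_not_mem _ (fun h => hy.1 h)]
  have heq := hharm.eq_of_eq_boundary hd Λ.finite_toSet hzero hb
  funext x
  have hx := heq x.2
  rw [zeroExtend_of_mem _ x.2, Pi.zero_apply, Pi.sub_apply, sub_eq_zero] at hx
  exact hx

/-- `M_Λ` is invertible (`d ≥ 1`). [folklore] -/
theorem isUnit_dirichletMatrix (hd : 0 < d) (Λ : Finset (Site d)) : IsUnit (dirichletMatrix Λ) :=
  Matrix.mulVec_injective_iff_isUnit.1 (mulVec_dirichletMatrix_injective hd Λ)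

/-- `det M_Λ` is a unit (`d ≥ 1`). [folklore] -/
theorem isUnit_det_dirichletMatrix (hd : 0 < d) (Λ : Finset (Site d)) :
    IsUnit (dirichletMatrix Λ).det :=
  (Matrix.isUnit_iff_isUnit_det _).1 (isUnit_dirichletMatrix hd Λ)

/-! ### The Dirichlet Green function -/

/-- The **Dirichlet Green function** of the finite set `Λ ⊆ ℤ^d`: `G_Λ(x,y) = (M_Λ⁻¹)_{xy}` for
`x, y ∈ Λ` and `0` otherwise (Lawler 1991, §1.5: the Green function of the walk killed on leaving
`Λ`; here `2d` times Lawler's `G_A`, matching `-Δ = 2d(I - P)`). [cite: Lawler1991, §1.5, p. 29] -/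
def dirichletGreen (Λ : Finset (Site d)) (x y : Site d) : ℝ :=
  if h : x ∈ Λ ∧ y ∈ Λ then (dirichletMatrix Λ)⁻¹ ⟨x, h.1⟩ ⟨y, h.2⟩ else 0

/-- `G_Λ` on `Λ × Λ`. [folklore] -/
theorem dirichletGreen_of_mem {Λ : Finset (Site d)} {x y : Site d} (hx : x ∈ Λ) (hy : y ∈ Λ) :
    dirichletGreen Λ x y = (dirichletMatrix Λ)⁻¹ ⟨x, hx⟩ ⟨y, hy⟩ := by
  simp only [dirichletGreen, hx, hy, and_self, dite_true]

/-- `G_Λ(x, ·)` vanishes off `Λ`. [folklore] -/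
theorem dirichletGreen_of_not_mem_right (Λ : Finset (Site d)) (x : Site d) {y : Site d}
    (hy : y ∉ Λ) : dirichletGreen Λ x y = 0 := by
  simp only [dirichletGreen, hy, and_false, dite_false]

/-- `G_Λ(·, y)` vanishes off `Λ`. [folklore] -/
theorem dirichletGreen_of_not_mem_left (Λ : Finset (Site d)) {x : Site d} (hx : x ∉ Λ)
    (y : Site d) : dirichletGreen Λ x y = 0 := by
  simp only [dirichletGreen, hx, false_and, dite_false]

/-- For `x ∈ Λ`, `G_Λ(x, ·)` is the zero extension of the row `(M_Λ⁻¹)_{x ·}`. [folklore] -/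
theorem dirichletGreen_eq_zeroExtend {Λ : Finset (Site d)} {x : Site d} (hx : x ∈ Λ) :
    dirichletGreen Λ x = zeroExtend Λ fun y => (dirichletMatrix Λ)⁻¹ ⟨x, hx⟩ y := by
  funext y
  by_cases hy : y ∈ Λ
  · rw [dirichletGreen_of_mem hx hy, zeroExtend_of_mem _ hy]
  · rw [dirichletGreen_of_not_mem_right Λ x hy, zeroExtend_of_not_mem _ hy]

/-- **`G_Λ` is symmetric** (`M_Λ` is). [folklore] -/
theorem dirichletGreen_comm (Λ : Finset (Site d)) (x y : Site d) :
    dirichletGreen Λ x y = dirichletGreen Λ y x := by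
  by_cases hx : x ∈ Λ
  · by_cases hy : y ∈ Λ
    · rw [dirichletGreen_of_mem hx hy, dirichletGreen_of_mem hy hx, ← transpose_apply
        ((dirichletMatrix Λ)⁻¹) ⟨y, hy⟩ ⟨x, hx⟩, transpose_nonsing_inv, dirichletMatrix_transpose]
    · rw [dirichletGreen_of_not_mem_right Λ x hy, dirichletGreen_of_not_mem_left Λ hy]
  · rw [dirichletGreen_of_not_mem_left Λ hx, dirichletGreen_of_not_mem_right Λ y hx]

/-- **The Poisson equation for `G_Λ`** (`d ≥ 1`): for `x ∈ ℤ^d` and `y ∈ Λ`,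
`-Δ_y G_Λ(x, ·) (y) = [x = y]` (for `x ∉ Λ` both sides vanish: `G_Λ(x, ·) ≡ 0`). This is the row
identity `M_Λ⁻¹ M_Λ = 1`. [cite: Lawler1991, §1.5, p. 29] -/
theorem neg_latticeLaplacianZd_dirichletGreen (hd : 0 < d) (Λ : Finset (Site d)) (x : Site d)
    {y : Site d} (hy : y ∈ Λ) :
    -latticeLaplacianZd (dirichletGreen Λ x) y = if x = y then 1 else 0 := by
  by_cases hx : x ∈ Λ
  · have hrow : (dirichletMatrix Λ *ᵥ fun w => (dirichletMatrix Λ)⁻¹ ⟨x, hx⟩ w) ⟨y, hy⟩ =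
        if x = y then 1 else 0 := by
      have h1 : (dirichletMatrix Λ *ᵥ fun w => (dirichletMatrix Λ)⁻¹ ⟨x, hx⟩ w) =
          (fun w => (dirichletMatrix Λ)⁻¹ ⟨x, hx⟩ w) ᵥ* dirichletMatrix Λ := by
        rw [← mulVec_transpose, dirichletMatrix_transpose]
      rw [h1]
      have h2 : ((fun w => (dirichletMatrix Λ)⁻¹ ⟨x, hx⟩ w) ᵥ* dirichletMatrix Λ) ⟨y, hy⟩ =
          ((dirichletMatrix Λ)⁻¹ * dirichletMatrix Λ) ⟨x, hx⟩ ⟨y, hy⟩ := by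
        rw [Matrix.mul_apply, vecMul, dotProduct]
      rw [h2, nonsing_inv_mul _ (isUnit_det_dirichletMatrix hd Λ), Matrix.one_apply]
      simp only [Subtype.mk.injEq]
    rw [← hrow, mulVec_dirichletMatrix, dirichletGreen_eq_zeroExtend hx]
  · have h0 : dirichletGreen Λ x = fun _ => 0 := by
      funext w; exact dirichletGreen_of_not_mem_left Λ hx w
    have hxy : x ≠ y := fun h => hx (h ▸ hy)
    rw [h0, if_neg hxy]
    have := latticeLaplacianZd_const (d := d) 0 y
    rw [this, neg_zero]

/-- The neighbour sum of `G_Λ(x, ·)` at `y ∈ Λ`: `∑_{w ∼ y} G_Λ(x,w) = 2d G_Λ(x,y) - [x = y]`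
(`d ≥ 1`). [folklore] -/
theorem sum_neighborFinset_dirichletGreen (hd : 0 < d) (Λ : Finset (Site d)) (x : Site d)
    {y : Site d} (hy : y ∈ Λ) :
    ∑ w ∈ (zdGraph d).neighborFinset y, dirichletGreen Λ x w =
      2 * d * dirichletGreen Λ x y - if x = y then 1 else 0 := by
  have h := neg_latticeLaplacianZd_dirichletGreen hd Λ x hy
  rw [latticeLaplacianZd_eq_sum_neighborFinset, Finset.sum_sub_distrib, Finset.sum_const,
    card_neighborFinset_zdGraph_holds, nsmul_eq_mul] at h
  push_cast at h
  linarith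

/-- **`G_Λ ≥ 0`** (`d ≥ 1`): `G_Λ(x, ·)` is superharmonic in `Λ` and vanishes outside, so the
minimum principle applies. [folklore] -/
theorem dirichletGreen_nonneg (hd : 0 < d) (Λ : Finset (Site d)) (x y : Site d) :
    0 ≤ dirichletGreen Λ x y := by
  by_cases hy : y ∈ Λ
  · have hsuper : IsZdSuperharmonicOn (dirichletGreen Λ x) ↑Λ := by
      intro w hw
      have h := neg_latticeLaplacianZd_dirichletGreen hd Λ x (Finset.mem_coe.1 hw)
      split_ifs at h <;> linarith
    refine hsuper.ge_of_forall_boundary_ge hd Λ.finite_toSet (M := 0) (fun z hz => ?_) y hy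
    rw [dirichletGreen_of_not_mem_right Λ x (fun h => hz.1 h)]
  · rw [dirichletGreen_of_not_mem_right Λ x hy]

/-! ### The Poisson kernel and Green's representation formula -/

/-- The **Poisson kernel** (harmonic measure) of `Λ`: for `z ∉ Λ`,
`H_Λ(x,z) = ∑_{w ∼ z} G_Λ(x,w)` (only `w ∈ Λ` contribute), and `0` for `z ∈ Λ`; for `x ∈ Λ` it is
the probability that the walk from `x` leaves `Λ` through `z` (Lawler 1991, §1.4, `H_A(x,y)`).
[cite: Lawler1991, §1.4, p. 21] -/
def poissonKernel (Λ : Finset (Site d)) (x z : Site d) : ℝ :=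
  if z ∈ Λ then 0 else ∑ w ∈ (zdGraph d).neighborFinset z, dirichletGreen Λ x w

/-- `H_Λ ≥ 0` (`d ≥ 1`). [folklore] -/
theorem poissonKernel_nonneg (hd : 0 < d) (Λ : Finset (Site d)) (x z : Site d) :
    0 ≤ poissonKernel Λ x z := by
  unfold poissonKernel
  split_ifs
  · exact le_rfl
  · exact Finset.sum_nonneg fun w _ => dirichletGreen_nonneg hd Λ x w

/-- `H_Λ(x, ·)` vanishes unless `x ∈ Λ`. [folklore] -/
theorem poissonKernel_of_not_mem_left (Λ : Finset (Site d)) {x : Site d} (hx : x ∉ Λ)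
    (z : Site d) : poissonKernel Λ x z = 0 := by
  unfold poissonKernel
  split_ifs
  · rfl
  · exact Finset.sum_eq_zero fun w _ => dirichletGreen_of_not_mem_left Λ hx w

/-- Swapping a double sum over `Λ` and lattice neighbours: for `g` vanishing off `Λ`,
`∑_{y ∈ Λ} g y ∑_{z ∼ y} F z = ∑_{z ∈ Λ ∪ ∂Λ} F z ∑_{y ∼ z} g y`. [folklore] -/
theorem sum_mul_sum_neighborFinset_eq (Λ : Finset (Site d)) {g : Site d → ℝ}
    (hg : ∀ y ∉ Λ, g y = 0) (F : Site d → ℝ) :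
    ∑ y ∈ Λ, g y * ∑ z ∈ (zdGraph d).neighborFinset y, F z =
      ∑ z ∈ Λ ∪ outerBoundary (zdGraph d) Λ, F z * ∑ y ∈ (zdGraph d).neighborFinset z, g y := by
  classical
  set T := Λ ∪ outerBoundary (zdGraph d) Λ with hT
  -- every neighbour of a point of `Λ` lies in `T`
  have hnb : ∀ y ∈ Λ, ∀ z ∈ (zdGraph d).neighborFinset y, z ∈ T := by
    intro y hy z hz
    rw [SimpleGraph.mem_neighborFinset] at hz
    by_cases hzΛ : z ∈ Λ
    · exact Finset.mem_union_left _ hzΛ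
    · exact Finset.mem_union_right _ (mem_outerBoundary_iff.2 ⟨hzΛ, y, hy, hz.symm⟩)
  have hL : ∑ y ∈ Λ, g y * ∑ z ∈ (zdGraph d).neighborFinset y, F z =
      ∑ y ∈ Λ, ∑ z ∈ T, if (zdGraph d).Adj y z then g y * F z else 0 := by
    refine Finset.sum_congr rfl fun y hy => ?_
    rw [Finset.mul_sum, ← Finset.sum_filter]
    refine Finset.sum_congr ?_ fun _ _ => rfl
    ext z
    simp only [SimpleGraph.mem_neighborFinset, Finset.mem_filter]
    exact ⟨fun h => ⟨hnb y hy z ((SimpleGraph.mem_neighborFinset _ _ _).2 h), h⟩, fun h => h.2⟩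
  have hR : ∑ z ∈ T, F z * ∑ y ∈ (zdGraph d).neighborFinset z, g y =
      ∑ z ∈ T, ∑ y ∈ Λ, if (zdGraph d).Adj y z then g y * F z else 0 := by
    refine Finset.sum_congr rfl fun z _ => ?_
    rw [← sum_filter_adj_eq_sum_neighborFinset Λ hg z, Finset.mul_sum, ← Finset.sum_filter]
    refine Finset.sum_congr ?_ fun y _ => by ring
    ext y
    simp only [Finset.mem_filter, (zdGraph d).adj_comm]
  rw [hL, hR, Finset.sum_comm]

/-- **Green's representation formula on a finite set** (`d ≥ 1`): for every `F : ℤ^d → ℝ` and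
`x ∈ Λ`, `F x = ∑_{y ∈ Λ} G_Λ(x,y) (-Δ F)(y) + ∑_{z ∈ ∂Λ} H_Λ(x,z) F z` — `F` is the Green
potential of `-Δ F` plus the harmonic extension of its boundary values (Lawler 1991, §1.4–1.5).
[cite: Lawler1991, §1.5, p. 29] -/
theorem green_representation (hd : 0 < d) (Λ : Finset (Site d)) (F : Site d → ℝ) {x : Site d}
    (hx : x ∈ Λ) :
    F x = ∑ y ∈ Λ, dirichletGreen Λ x y * (-latticeLaplacianZd F y) +
      ∑ z ∈ outerBoundary (zdGraph d) Λ, poissonKernel Λ x z * F z := by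
  classical
  have hcard := card_neighborFinset_zdGraph_holds (d := d)
  -- `-Δ F (y) = 2d F y - ∑_{z ∼ y} F z`
  have hlap : ∀ y, -latticeLaplacianZd F y =
      2 * d * F y - ∑ z ∈ (zdGraph d).neighborFinset y, F z := by
    intro y
    rw [latticeLaplacianZd_eq_sum_neighborFinset, Finset.sum_sub_distrib, Finset.sum_const, hcard y,
      nsmul_eq_mul]
    push_cast
    ring
  simp_rw [hlap, mul_sub, Finset.sum_sub_distrib]
  rw [sum_mul_sum_neighborFinset_eq Λ (fun y hy => dirichletGreen_of_not_mem_right Λ x hy) F,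
    Finset.sum_union (Finset.disjoint_left.2 fun z hz hz' => (mem_outerBoundary_iff.1 hz').1 hz)]
  -- the part over `Λ`
  have hin : ∑ z ∈ Λ, F z * ∑ y ∈ (zdGraph d).neighborFinset z, dirichletGreen Λ x y =
      ∑ z ∈ Λ, dirichletGreen Λ x z * (2 * d * F z) - F x := by
    have h1 : ∑ z ∈ Λ, F z * ∑ y ∈ (zdGraph d).neighborFinset z, dirichletGreen Λ x y =
        ∑ z ∈ Λ, (dirichletGreen Λ x z * (2 * d * F z) - if x = z then F z else 0) := by
      refine Finset.sum_congr rfl fun z hz => ?_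
      rw [sum_neighborFinset_dirichletGreen hd Λ x hz]
      split_ifs <;> ring
    rw [h1, Finset.sum_sub_distrib, Finset.sum_ite_eq, if_pos hx]
  -- the part over `∂Λ`
  have hout : ∑ z ∈ outerBoundary (zdGraph d) Λ,
      F z * ∑ y ∈ (zdGraph d).neighborFinset z, dirichletGreen Λ x y =
      ∑ z ∈ outerBoundary (zdGraph d) Λ, poissonKernel Λ x z * F z := by
    refine Finset.sum_congr rfl fun z hz => ?_
    rw [poissonKernel, if_neg (mem_outerBoundary_iff.1 hz).1, mul_comm]
  rw [hin, hout]
  ring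

/-- **`∑_{z ∈ ∂Λ} H_Λ(x,z) = 1`** for `x ∈ Λ` (`d ≥ 1`): the walk leaves the finite set `Λ`
almost surely (Green's formula for `F ≡ 1`). [cite: Lawler1991, §1.4, p. 21] -/
theorem sum_poissonKernel (hd : 0 < d) (Λ : Finset (Site d)) {x : Site d} (hx : x ∈ Λ) :
    ∑ z ∈ outerBoundary (zdGraph d) Λ, poissonKernel Λ x z = 1 := by
  have h := green_representation hd Λ (fun _ => (1 : ℝ)) hx
  simp only [latticeLaplacianZd_const, neg_zero, mul_zero, Finset.sum_const_zero, zero_add,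
    mul_one] at h
  exact h.symm

end Literature.Probability.LatticeModels
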